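import Mathlib.Order.CompactlyGenerated.Basic
import Literature.NumberTheory.Automorphic.AutomorphicRepsGLAssociatedL2Proofs
import HarnessLib

/-!
# The lattice of `(𝔤, K_∞) × G(𝔸_f)`-stable subspaces of a stable space of automorphic forms

Topic `NumberTheory/Automorphic`; general automorphy data (Borel–Jacquet 1979, §4). For an
automorphy datum `𝒟` over an adelic group datum `𝒢` and a `(𝔤, K_∞) × G(𝔸_f)`-stable subspace
`V` of the space of automorphic forms (`IsStableSubmodule 𝒟 V`: `V ≤ 𝒜`, stable under right
translation by `G(𝔸_f)` and `K_∞` and under the Lie derivatives `X φ`, `X ∈ 𝔤`), the stable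
subspaces `S ≤ V` are the sub*modules* of the `(𝔤, K_∞) × G(𝔸_f)`-module `V`. `Literature` has
no category of such modules (the Lie derivative `lieDeriv` is additive only on functions smooth in
the archimedean variable, so `V` is not a Mathlib `Module` over some ring whose `Submodule`s are
the stable subspaces), but everything the module theory of `𝒜` needs from "submodule" is
order-theoretic. This file provides that order theory, fully proved:

* `IsStableSubmodule.iSup`, `IsStableSubmodule.inf_iInf`: stable subspaces are closed under
  arbitrary joins and under meets with a stable space (so under arbitrary non-empty meets);
* `StableBelow 𝒟 V`: the type of stable subspaces of `V`, a **complete lattice**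
  (`instCompleteLattice`, for `V` stable, supplied as `[Fact (IsStableSubmodule 𝒟 V)]`) whose
  order, `⊔`, `⊓`, `sSup` are those of `Submodule ℂ (G(𝔸_K) → ℂ)` (`coe_sup`, `coe_inf`,
  `coe_sSup`, `coe_iSup`, `coe_bot`; `⊤ = V`, `coe_top`; `sInf F = V ⊓ ⨅ F`, `coe_sInf`);
* it is **modular** (`instIsModularLattice`, from the modular lattice of submodules) and
  **compactly generated** (`instIsCompactlyGenerated`: every stable subspace is the join of the
  stable closures `StableBelow.closure φ` of its elements, which are compact elements,
  `isCompactElement_closure`);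
* its **atoms are the irreducible stable subspaces** of `V` (`isAtom_iff`: `S ≠ ⊥` and the only
  stable subspaces of `S` are `⊥` and `S`, i.e. `S / ⊥` is an automorphic representation datum in
  the sense of Borel–Jacquet 4.6);
* consequently (Mathlib's `complementedLattice_of_sSup_atoms_eq_top`,
  `isAtomistic_of_complementedLattice`, [Călugăreanu, *Lattice concepts of module theory*,
  Thm. 6.6]): **if `V` is the sum of its irreducible stable subspaces, then so is every stable
  `W ≤ V`** (`sSup_atoms_le_eq_of_sSup_atoms_eq_top`, and on the level of submodules
  `IsStableSubmodule.eq_sSup_irreducibleStableBelow_of_le`, with the set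
  `irreducibleStableBelow 𝒟 W` of irreducible stable subspaces of `W`), **and every stable
  `W' ≤ W` has a stable complement in `W`** (`exists_isCompl_of_sSup_atoms_eq_top`,
  `IsStableSubmodule.exists_stable_compl_of_le`) — the lattice form of "a submodule of a
  semisimple module is semisimple and completely reducible" (Lang, *Algebra*, XVII §2) for
  spaces of automorphic forms.

These are the algebraic steps in the passage from the spectral decomposition of `L²_cusp` to
the semisimplicity of spaces of cusp forms (Borel–Jacquet 1979, 4.6; Getz–Hahn 2024, Cor. 9.1.2
and Thm. 6.5.1): they reduce the semisimplicity of the `(𝔤, K_∞) × GL_n(𝔸^∞)`-module of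
`A_G`-invariant cusp forms on `GL_n` (named fact `AutomorphicRepsGL.stable_cuspidal_eq_sSup_irreducible`
of `AutomorphicRepsGLCuspidalSemisimple`) to the statement that every `A_G`-invariant cusp form
is a finite sum of automorphic forms lying in irreducible closed subspaces of `L²_cusp`
(carried out in a sibling file).

## Design notes

* `StableBelow 𝒟 V` is the subtype `{S // IsStableSubmodule 𝒟 S ∧ S ≤ V}`; the complete lattice
  structure needs `V` itself to be stable (for `⊤` and for meets of the empty family), which is
  supplied as a `Fact` so that the structure is an instance; the final submodule-level
  statements take `hV : IsStableSubmodule 𝒟 V` explicitly.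
* Atoms are characterised by the explicit condition (`isAtom_iff`; as a set of submodules,
  `irreducibleStableBelow`), so that this file depends only on `IsStableSubmodule` (the
  `structure IsIrreducibleStableSubmodule` of `AutomorphicRepsGLCuspidalSemisimple` packages the
  same three conditions).
* Imports `Mathlib.Order.CompactlyGenerated.Basic` and the file providing
  `IsStableSubmodule.inf` / `IsStableSubmodule.sup`; (H5) `open scoped Classical`; no `sorry`.

## References

* A. Borel, H. Jacquet, *Automorphic forms and automorphic representations*, Proc. Sympos. Pure
  Math. 33 (1979), Part 1, §4.3–4.6 [BorelJacquet1979].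
* G. Călugăreanu, *Lattice Concepts of Module Theory*, Kluwer (2000), Thm. 6.6 (Mathlib
  `complementedLattice_of_sSup_atoms_eq_top`).
* S. Lang, *Algebra*, 3rd ed. (2002), XVII §2 [Lang2002].
* J. R. Getz, H. Hahn, *An Introduction to Automorphic Representations* (2024), Cor. 9.1.2,
  Thm. 6.5.1 [GetzHahn2024].
-/

open scoped MatrixGroups Matrix ContDiff Classical

noncomputable section

namespace Literature.NumberTheory.Automorphic

variable {K : Type} [Field K] [NumberField K]
  {A : Type*} [NormedCommRing A] [NormedAlgebra ℝ A] [NormedAlgebra ℚ A] [CompleteSpace A]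
  [StarRing A] {N : Type*} [Fintype N] [DecidableEq N]
  {𝒢 : AdelicGroupData K} {𝒟 : AutomorphyDatum 𝒢 A N}

/-! ### 1. Arbitrary joins and meets of stable subspaces -/

section Closure

/-- The Lie derivative of the zero function vanishes. [folklore] -/
theorem lieDeriv_zero (X : 𝒟.arch.lie) :
    lieDeriv 𝒟.ofArch X (0 : 𝒢.Adelic → ℂ) = 0 := by
  have h := lieDeriv_smul (ι := 𝒟.ofArch) X (0 : ℂ) (0 : 𝒢.Adelic → ℂ)
  rwa [zero_smul, zero_smul] at h

/-- The join of any family of `(𝔤, K_∞) × G(𝔸_f)`-stable subspaces of the space of automorphic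
forms is stable (for the Lie derivatives: an element of the join is a finite sum of elements of
the members, on which — being smooth in the archimedean variable — the Lie derivative is additive,
`IsArchSmooth.lieDeriv_add`). Borel–Jacquet 1979, 4.3 and 4.6 (submodules of `𝒜`). [folklore] -/
theorem IsStableSubmodule.iSup {ι : Sort*} {W : ι → Submodule ℂ (𝒢.Adelic → ℂ)}
    (h : ∀ i, IsStableSubmodule 𝒟 (W i)) : IsStableSubmodule 𝒟 (⨆ i, W i) where
  le_automorphicForms := iSup_le fun i ↦ (h i).le_automorphicForms
  finite_stable g hg :=
    iSup_le fun i ↦ ((h i).finite_stable g hg).trans (Submodule.comap_mono (le_iSup W i))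
  k_stable k := iSup_le fun i ↦ ((h i).k_stable k).trans (Submodule.comap_mono (le_iSup W i))
  lie_stable X φ hφ := by
    refine (Submodule.iSup_induction W
      (motive := fun ψ ↦ IsArchSmooth 𝒟.ofArch ψ ∧ lieDeriv 𝒟.ofArch X ψ ∈ ⨆ i, W i) hφ
      (fun i ψ hψ ↦ ⟨(h i).isArchSmooth hψ, Submodule.mem_iSup_of_mem i ((h i).lie_stable X ψ hψ)⟩)
      ⟨(archSmooth 𝒟.ofArch).zero_mem, by rw [lieDeriv_zero]; exact Submodule.zero_mem _⟩
      fun ψ₁ ψ₂ h₁ h₂ ↦ ⟨h₁.1.add 𝒟.ofArch h₂.1, ?_⟩).2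
    rw [IsArchSmooth.lieDeriv_add 𝒟.ofArch X h₁.1 h₂.1]
    exact Submodule.add_mem _ h₁.2 h₂.2

/-- The meet of a stable subspace `V` with the meet of any family of stable subspaces is stable
(for the empty family this is `V` itself). Borel–Jacquet 1979, 4.3 and 4.6. [folklore] -/
theorem IsStableSubmodule.inf_iInf {ι : Sort*} {V : Submodule ℂ (𝒢.Adelic → ℂ)}
    {W : ι → Submodule ℂ (𝒢.Adelic → ℂ)} (hV : IsStableSubmodule 𝒟 V)
    (h : ∀ i, IsStableSubmodule 𝒟 (W i)) : IsStableSubmodule 𝒟 (V ⊓ ⨅ i, W i) where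
  le_automorphicForms := inf_le_left.trans hV.le_automorphicForms
  finite_stable g hg := by
    intro φ hφ
    obtain ⟨hφV, hφW⟩ := Submodule.mem_inf.mp hφ
    refine Submodule.mem_comap.mpr (Submodule.mem_inf.mpr ⟨hV.finite_stable g hg hφV, ?_⟩)
    exact (Submodule.mem_iInf _).mpr fun i ↦
      (h i).finite_stable g hg ((Submodule.mem_iInf _).mp hφW i)
  k_stable k := by
    intro φ hφ
    obtain ⟨hφV, hφW⟩ := Submodule.mem_inf.mp hφ
    refine Submodule.mem_comap.mpr (Submodule.mem_inf.mpr ⟨hV.k_stable k hφV, ?_⟩)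
    exact (Submodule.mem_iInf _).mpr fun i ↦ (h i).k_stable k ((Submodule.mem_iInf _).mp hφW i)
  lie_stable X φ hφ := by
    obtain ⟨hφV, hφW⟩ := Submodule.mem_inf.mp hφ
    exact Submodule.mem_inf.mpr ⟨hV.lie_stable X φ hφV,
      (Submodule.mem_iInf _).mpr fun i ↦ (h i).lie_stable X φ ((Submodule.mem_iInf _).mp hφW i)⟩

end Closure

/-! ### 2. The complete lattice of stable subspaces of a stable space -/

/-- The **stable subspaces of `V`**: the `(𝔤, K_∞) × G(𝔸_f)`-stable subspaces `S` of the space of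
automorphic forms (`IsStableSubmodule 𝒟 S`) contained in `V` — for `V` stable, the submodules of
the `(𝔤, K_∞) × G(𝔸_f)`-module `V`. Borel–Jacquet 1979, 4.3 and 4.6. [cite: BorelJacquet1979, 4.6] -/
def StableBelow (𝒟 : AutomorphyDatum 𝒢 A N) (V : Submodule ℂ (𝒢.Adelic → ℂ)) : Type _ :=
  {S : Submodule ℂ (𝒢.Adelic → ℂ) // IsStableSubmodule 𝒟 S ∧ S ≤ V}

namespace StableBelow

variable {V : Submodule ℂ (𝒢.Adelic → ℂ)}

/-- A stable subspace of `V` is stable. [folklore] -/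
theorem isStableSubmodule (S : StableBelow 𝒟 V) : IsStableSubmodule 𝒟 S.1 := S.2.1

/-- A stable subspace of `V` is contained in `V`. [folklore] -/
theorem le_ambient (S : StableBelow 𝒟 V) : S.1 ≤ V := S.2.2

/-- Two stable subspaces of `V` with the same underlying subspace are equal. [folklore] -/
@[ext]
theorem ext {S T : StableBelow 𝒟 V} (h : S.1 = T.1) : S = T := Subtype.ext h

/-- A stable subspace `S ≤ V` as an element of `StableBelow 𝒟 V`. [folklore] -/
protected def mk (S : Submodule ℂ (𝒢.Adelic → ℂ)) (hS : IsStableSubmodule 𝒟 S) (hle : S ≤ V) :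
    StableBelow 𝒟 V :=
  ⟨S, hS, hle⟩

/-- The underlying subspace of `StableBelow.mk S _ _` is `S` (definitional). [folklore] -/
@[simp]
theorem coe_mk (S : Submodule ℂ (𝒢.Adelic → ℂ)) (hS : IsStableSubmodule 𝒟 S) (hle : S ≤ V) :
    (StableBelow.mk S hS hle : StableBelow 𝒟 V).1 = S := rfl

/-- **The stable subspaces of a stable space `V` form a complete lattice**, with the order,
binary and arbitrary joins and binary meets of `Submodule ℂ (G(𝔸_K) → ℂ)`
(`IsStableSubmodule.sup`, `IsStableSubmodule.iSup`, `IsStableSubmodule.inf`), top `V`, bottom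
`⊥`, and `sInf F = V ⊓ ⨅ F` (`IsStableSubmodule.inf_iInf`). Borel–Jacquet 1979, 4.3 and 4.6
(the lattice of submodules of the `(𝔤, K_∞) × G(𝔸_f)`-module `V`). [folklore] -/
instance instCompleteLattice [hV : Fact (IsStableSubmodule 𝒟 V)] :
    CompleteLattice (StableBelow 𝒟 V) where
  le S T := S.1 ≤ T.1
  le_refl S := le_refl S.1
  le_trans _ _ _ h h' := le_trans h h'
  le_antisymm _ _ h h' := Subtype.ext (le_antisymm h h')
  sup S T := ⟨S.1 ⊔ T.1, S.2.1.sup T.2.1, sup_le S.2.2 T.2.2⟩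
  le_sup_left S T := (le_sup_left : S.1 ≤ S.1 ⊔ T.1)
  le_sup_right S T := (le_sup_right : T.1 ≤ S.1 ⊔ T.1)
  sup_le _ _ _ h h' := sup_le h h'
  inf S T := ⟨S.1 ⊓ T.1, S.2.1.inf T.2.1, inf_le_left.trans S.2.2⟩
  inf_le_left S T := (inf_le_left : S.1 ⊓ T.1 ≤ S.1)
  inf_le_right S T := (inf_le_right : S.1 ⊓ T.1 ≤ T.1)
  le_inf _ _ _ h h' := le_inf h h'
  sSup F := ⟨⨆ T : F, T.1.1, IsStableSubmodule.iSup fun T ↦ T.1.2.1, iSup_le fun T ↦ T.1.2.2⟩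
  isLUB_sSup F :=
    ⟨fun S hS ↦ (le_iSup (fun T : F ↦ T.1.1) ⟨S, hS⟩ : S.1 ≤ ⨆ T : F, T.1.1),
      fun S h ↦ (iSup_le fun T : F ↦ h T.2 : (⨆ T : F, T.1.1) ≤ S.1)⟩
  sInf F := ⟨V ⊓ ⨅ T : F, T.1.1, hV.out.inf_iInf fun T ↦ T.1.2.1, inf_le_left⟩
  isGLB_sInf F :=
    ⟨fun S hS ↦
        (inf_le_right.trans (iInf_le (fun T : F ↦ T.1.1) ⟨S, hS⟩) : V ⊓ ⨅ T : F, T.1.1 ≤ S.1),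
      fun S h ↦ (le_inf S.2.2 (le_iInf fun T : F ↦ h T.2) : S.1 ≤ V ⊓ ⨅ T : F, T.1.1)⟩
  top := ⟨V, hV.out, le_rfl⟩
  le_top S := S.2.2
  bot := ⟨⊥, isStableSubmodule_bot 𝒟, bot_le⟩
  bot_le S := (bot_le : (⊥ : Submodule ℂ (𝒢.Adelic → ℂ)) ≤ S.1)

variable [Fact (IsStableSubmodule 𝒟 V)]

/-- The order on stable subspaces is inclusion. [folklore] -/
theorem le_iff {S T : StableBelow 𝒟 V} : S ≤ T ↔ S.1 ≤ T.1 := Iff.rfl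

/-- The strict order on stable subspaces is strict inclusion. [folklore] -/
theorem lt_iff {S T : StableBelow 𝒟 V} : S < T ↔ S.1 < T.1 := by
  rw [lt_iff_le_not_ge, lt_iff_le_not_ge, le_iff, le_iff]

/-- `⊤ = V`. [folklore] -/
@[simp] theorem coe_top : (⊤ : StableBelow 𝒟 V).1 = V := rfl

/-- `⊥ = 0`. [folklore] -/
@[simp] theorem coe_bot : (⊥ : StableBelow 𝒟 V).1 = ⊥ := rfl

/-- Binary joins are those of submodules. [folklore] -/
@[simp] theorem coe_sup (S T : StableBelow 𝒟 V) : (S ⊔ T).1 = S.1 ⊔ T.1 := rfl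

/-- Binary meets are those of submodules. [folklore] -/
@[simp] theorem coe_inf (S T : StableBelow 𝒟 V) : (S ⊓ T).1 = S.1 ⊓ T.1 := rfl

/-- Arbitrary joins are those of submodules. [folklore] -/
theorem coe_sSup (F : Set (StableBelow 𝒟 V)) : (sSup F).1 = ⨆ T : F, T.1.1 := rfl

/-- Arbitrary meets are `V ⊓` those of submodules (so that the empty meet is `V`). [folklore] -/
theorem coe_sInf (F : Set (StableBelow 𝒟 V)) : (sInf F).1 = V ⊓ ⨅ T : F, T.1.1 := rfl

/-- Indexed joins are those of submodules. [folklore] -/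
theorem coe_iSup {ι : Sort*} (f : ι → StableBelow 𝒟 V) : (⨆ i, f i).1 = ⨆ i, (f i).1 := by
  refine le_antisymm ?_ (iSup_le fun i ↦ (le_iSup f i : f i ≤ ⨆ i, f i))
  change (⨆ T : Set.range f, T.1.1) ≤ ⨆ i, (f i).1
  refine iSup_le fun T ↦ ?_
  obtain ⟨_, i, rfl⟩ := T
  exact le_iSup (fun i ↦ (f i).1) i

/-- Joins over a set, indexed by its elements, are those of submodules. [folklore] -/
theorem coe_biSup (F : Set (StableBelow 𝒟 V)) : (⨆ T ∈ F, T).1 = ⨆ T ∈ F, T.1 := by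
  rw [← sSup_eq_iSup, coe_sSup, iSup_subtype']

/-- `S = ⊥` iff its underlying subspace is `0`. [folklore] -/
theorem eq_bot_iff_coe {S : StableBelow 𝒟 V} : S = ⊥ ↔ S.1 = ⊥ :=
  ⟨fun h ↦ congrArg Subtype.val h, fun h ↦ Subtype.ext h⟩

/-- **Modularity.** The lattice of stable subspaces of `V` is modular (it is a sublattice of the
modular lattice of `ℂ`-subspaces). [folklore] -/
instance instIsModularLattice : IsModularLattice (StableBelow 𝒟 V) where
  sup_inf_le_assoc_of_le := fun {_} y {_} h ↦ IsModularLattice.sup_inf_le_assoc_of_le y.1 h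

/-! ### 3. Compact generation: stable closures of elements -/

/-- The **stable closure** of a function `φ` inside `V`: the meet of the stable subspaces of `V`
containing `φ` (the submodule generated by `φ`, when `φ ∈ V`). Borel–Jacquet 1979, 4.6 (the
`(𝔤, K_∞) × G(𝔸_f)`-module generated by an automorphic form). [folklore] -/
def closure (φ : 𝒢.Adelic → ℂ) : StableBelow 𝒟 V :=
  sInf {S | φ ∈ S.1}

/-- `φ ∈ V` lies in its stable closure. [folklore] -/
theorem mem_closure {φ : 𝒢.Adelic → ℂ} (hφ : φ ∈ V) : φ ∈ (closure φ : StableBelow 𝒟 V).1 := by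
  change φ ∈ V ⊓ ⨅ T : {S : StableBelow 𝒟 V | φ ∈ S.1}, T.1.1
  exact Submodule.mem_inf.mpr ⟨hφ, (Submodule.mem_iInf _).mpr fun T ↦ T.2⟩

/-- The stable closure of `φ` is contained in every stable subspace of `V` containing `φ`. [folklore] -/
theorem closure_le {φ : 𝒢.Adelic → ℂ} {S : StableBelow 𝒟 V} (h : φ ∈ S.1) : closure φ ≤ S :=
  sInf_le h

/-- **Stable closures of elements are compact**: if `closure φ ≤ sSup s` for a non-empty directed
set `s` of stable subspaces, then `closure φ ≤ S` for some `S ∈ s` (an element of a directed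
union of subspaces lies in one of them). [folklore] -/
theorem isCompactElement_closure {φ : 𝒢.Adelic → ℂ} (hφ : φ ∈ V) :
    IsCompactElement (closure φ : StableBelow 𝒟 V) := by
  rw [CompleteLattice.isCompactElement_iff_le_of_directed_sSup_le]
  intro s hne hdir hle
  have hmem : φ ∈ (sSup s).1 := hle (mem_closure hφ)
  haveI : Nonempty s := hne.to_subtype
  have hdir' : Directed (· ≤ ·) fun T : s ↦ T.1.1 := hdir.directed_val
  obtain ⟨T, hT⟩ := (Submodule.mem_iSup_of_directed _ hdir').mp hmem
  exact ⟨T.1, T.2, closure_le hT⟩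

/-- Every stable subspace of `V` is the join of the stable closures of its elements. [folklore] -/
theorem sSup_closure_eq (S : StableBelow 𝒟 V) :
    sSup {T : StableBelow 𝒟 V | ∃ φ ∈ S.1, T = closure φ} = S := by
  refine le_antisymm (sSup_le ?_) fun φ hφ ↦ ?_
  · rintro _ ⟨φ, hφ, rfl⟩
    exact closure_le hφ
  · exact (le_sSup ⟨φ, hφ, rfl⟩ : closure φ ≤ sSup {T : StableBelow 𝒟 V | ∃ φ ∈ S.1, T = closure φ})
      (mem_closure (S.2.2 hφ))

/-- **Compact generation.** The lattice of stable subspaces of `V` is compactly generated (by the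
stable closures of elements). [folklore] -/
instance instIsCompactlyGenerated : IsCompactlyGenerated (StableBelow 𝒟 V) where
  exists_sSup_eq S :=
    ⟨{T | ∃ φ ∈ S.1, T = closure φ}, by
      rintro _ ⟨φ, hφ, rfl⟩
      exact isCompactElement_closure (S.2.2 hφ), sSup_closure_eq S⟩

/-! ### 4. Atoms are the irreducible stable subspaces; atomisticity and complements -/

/-- **Atoms are the irreducible stable subspaces.** A stable subspace `S ≤ V` is an atom of the
lattice iff `S ≠ 0` and its only stable subspaces are `0` and `S` (i.e. `S / 0` is an
automorphic representation datum realised on a submodule; Borel–Jacquet 1979, 4.6). [cite: BorelJacquet1979, 4.6] -/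
theorem isAtom_iff {S : StableBelow 𝒟 V} :
    IsAtom S ↔ S.1 ≠ ⊥ ∧ ∀ S' : Submodule ℂ (𝒢.Adelic → ℂ), S' ≤ S.1 →
      IsStableSubmodule 𝒟 S' → S' = ⊥ ∨ S' = S.1 := by
  constructor
  · intro h
    refine ⟨fun h0 ↦ h.1 (eq_bot_iff_coe.mpr h0), fun S' hle hst ↦ ?_⟩
    by_cases heq : S' = S.1
    · exact Or.inr heq
    · refine Or.inl ?_
      have hlt : StableBelow.mk S' hst (hle.trans S.2.2) < S :=
        lt_of_le_of_ne (show S' ≤ S.1 from hle) fun hTS ↦ heq (congrArg Subtype.val hTS)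
      exact congrArg Subtype.val (h.2 _ hlt)
  · intro h
    refine ⟨fun hS ↦ h.1 (eq_bot_iff_coe.mp hS), fun T hlt ↦ ?_⟩
    rcases h.2 T.1 hlt.le T.2.1 with h0 | hT
    · exact eq_bot_iff_coe.mpr h0
    · exact absurd (Subtype.ext hT) hlt.ne

/-- **Atomisticity below a sum of irreducibles** (Călugăreanu, Thm. 6.6, through Mathlib's
`complementedLattice_of_sSup_atoms_eq_top` and `isAtomistic_of_complementedLattice` for the
modular, compactly generated lattice `StableBelow 𝒟 V`): if `V` is the join of its irreducible
stable subspaces, then every stable `W ≤ V` is the join of the irreducible stable subspaces it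
contains — "a submodule of a semisimple module is semisimple" (Lang, *Algebra*, XVII §2) for the
`(𝔤, K_∞) × G(𝔸_f)`-module `V`. [cite: Lang2002, XVII §2] -/
theorem sSup_atoms_le_eq_of_sSup_atoms_eq_top
    (htop : sSup {a : StableBelow 𝒟 V | IsAtom a} = ⊤) (W : StableBelow 𝒟 V) :
    sSup {a : StableBelow 𝒟 V | IsAtom a ∧ a ≤ W} = W := by
  haveI : ComplementedLattice (StableBelow 𝒟 V) := complementedLattice_of_sSup_atoms_eq_top htop
  exact sSup_atoms_le_eq W

/-- **Complements below a sum of irreducibles**: if `V` is the join of its irreducible stable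
subspaces, then for stable `W' ≤ W ≤ V` there is a stable `W₀ ≤ W`, a join of independent
irreducible stable subspaces, with `W' ⊓ W₀ = ⊥` and `W' ⊔ W₀ = W` (complete reducibility;
Mathlib's `exists_sSupIndep_disjoint_sSup_atoms`). Lang, *Algebra*, XVII §2. [cite: Lang2002, XVII §2] -/
theorem exists_isCompl_of_sSup_atoms_eq_top
    (htop : sSup {a : StableBelow 𝒟 V | IsAtom a} = ⊤) {W' W : StableBelow 𝒟 V} (hle : W' ≤ W) :
    ∃ s : Set (StableBelow 𝒟 V), sSupIndep s ∧ Disjoint W' (sSup s) ∧ W' ⊔ sSup s = W ∧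
      ∀ ⦃a⦄, a ∈ s → IsAtom a :=
  exists_sSupIndep_disjoint_sSup_atoms W' W hle
    (by simpa only [and_comm] using sSup_atoms_le_eq_of_sSup_atoms_eq_top htop W)

end StableBelow

/-! ### 5. The same, stated for submodules -/

section Submodules

variable {V : Submodule ℂ (𝒢.Adelic → ℂ)}

/-- The set of **irreducible stable subspaces** of the space of functions contained in `W`
(stable, non-zero, with no stable subspace other than `⊥` and itself), as a set of submodules.
Borel–Jacquet 1979, 4.6. [cite: BorelJacquet1979, 4.6] -/
def irreducibleStableBelow (𝒟 : AutomorphyDatum 𝒢 A N) (W : Submodule ℂ (𝒢.Adelic → ℂ)) :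
    Set (Submodule ℂ (𝒢.Adelic → ℂ)) :=
  {S | S ≤ W ∧ IsStableSubmodule 𝒟 S ∧ S ≠ ⊥ ∧
    ∀ S' : Submodule ℂ (𝒢.Adelic → ℂ), S' ≤ S → IsStableSubmodule 𝒟 S' → S' = ⊥ ∨ S' = S}

/-- Membership in `irreducibleStableBelow` (definitional). [folklore] -/
theorem mem_irreducibleStableBelow_iff {W S : Submodule ℂ (𝒢.Adelic → ℂ)} :
    S ∈ irreducibleStableBelow 𝒟 W ↔ S ≤ W ∧ IsStableSubmodule 𝒟 S ∧ S ≠ ⊥ ∧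
      ∀ S' : Submodule ℂ (𝒢.Adelic → ℂ), S' ≤ S → IsStableSubmodule 𝒟 S' → S' = ⊥ ∨ S' = S :=
  Iff.rfl

/-- `irreducibleStableBelow` is monotone in the ambient space. [folklore] -/
theorem irreducibleStableBelow_mono {W W' : Submodule ℂ (𝒢.Adelic → ℂ)} (h : W ≤ W') :
    irreducibleStableBelow 𝒟 W ⊆ irreducibleStableBelow 𝒟 W' :=
  fun _ hS ↦ ⟨hS.1.trans h, hS.2⟩

/-- The atoms of `StableBelow 𝒟 V` below `W` are the irreducible stable subspaces of `W`
(for `W ≤ V`): the underlying-subspace map is a bijection between the two sets. [folklore] -/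
theorem StableBelow.isAtom_and_le_iff [Fact (IsStableSubmodule 𝒟 V)] {S : StableBelow 𝒟 V}
    {W : Submodule ℂ (𝒢.Adelic → ℂ)} :
    (IsAtom S ∧ S.1 ≤ W) ↔ S.1 ∈ irreducibleStableBelow 𝒟 W := by
  rw [StableBelow.isAtom_iff, mem_irreducibleStableBelow_iff]
  exact ⟨fun h ↦ ⟨h.2, S.2.1, h.1.1, h.1.2⟩, fun h ↦ ⟨⟨h.2.2.1, h.2.2.2⟩, h.1⟩⟩

/-- **A stable subspace of a sum of irreducible stable subspaces is the sum of its irreducible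
stable subspaces.** If the stable space `V` is contained in (hence equal to) the sum of its
irreducible stable subspaces, then every stable `W ≤ V` equals the sum of the irreducible stable
subspaces it contains ("submodules of semisimple modules are semisimple", Lang, *Algebra*,
XVII §2, for the `(𝔤, K_∞) × G(𝔸_f)`-module `V`; via `StableBelow.sSup_atoms_le_eq_of_sSup_atoms_eq_top`). [cite: Lang2002, XVII §2] -/
theorem IsStableSubmodule.eq_sSup_irreducibleStableBelow_of_le (hV : IsStableSubmodule 𝒟 V)
    (hVat : V ≤ sSup (irreducibleStableBelow 𝒟 V)) {W : Submodule ℂ (𝒢.Adelic → ℂ)}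
    (hW : IsStableSubmodule 𝒟 W) (hWV : W ≤ V) :
    W = sSup (irreducibleStableBelow 𝒟 W) := by
  haveI : Fact (IsStableSubmodule 𝒟 V) := ⟨hV⟩
  -- `⊤ = V` is the join of the atoms
  have htop : sSup {a : StableBelow 𝒟 V | IsAtom a} = ⊤ := by
    refine top_le_iff.mp ?_
    change V ≤ (sSup {a : StableBelow 𝒟 V | IsAtom a}).1
    refine hVat.trans (sSup_le fun S hS ↦ ?_)
    have hat : IsAtom (StableBelow.mk S hS.2.1 hS.1 : StableBelow 𝒟 V) :=
      StableBelow.isAtom_iff.mpr ⟨hS.2.2.1, hS.2.2.2⟩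
    exact (le_sSup hat : StableBelow.mk S hS.2.1 hS.1 ≤ sSup {a : StableBelow 𝒟 V | IsAtom a})
  -- atomisticity at `W`
  have hW' := StableBelow.sSup_atoms_le_eq_of_sSup_atoms_eq_top htop (StableBelow.mk W hW hWV)
  have hcoe : (sSup {a : StableBelow 𝒟 V | IsAtom a ∧ a ≤ StableBelow.mk W hW hWV}).1 = W :=
    congrArg Subtype.val hW'
  refine le_antisymm ?_ (sSup_le fun S hS ↦ hS.1)
  calc W = (sSup {a : StableBelow 𝒟 V | IsAtom a ∧ a ≤ StableBelow.mk W hW hWV}).1 := hcoe.symm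
    _ ≤ sSup (irreducibleStableBelow 𝒟 W) := by
        rw [StableBelow.coe_sSup]
        refine iSup_le fun T ↦ le_sSup ?_
        exact StableBelow.isAtom_and_le_iff.mp T.2

/-- **Complete reducibility below a sum of irreducibles.** If the stable space `V` is contained
in the sum of its irreducible stable subspaces, then for stable `W' ≤ W ≤ V` there is a stable
`W₀ ≤ W` with `W' ⊓ W₀ = ⊥` and `W' ⊔ W₀ = W`. Lang, *Algebra*, XVII §2. [cite: Lang2002, XVII §2] -/
theorem IsStableSubmodule.exists_stable_compl_of_le (hV : IsStableSubmodule 𝒟 V)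
    (hVat : V ≤ sSup (irreducibleStableBelow 𝒟 V)) {W' W : Submodule ℂ (𝒢.Adelic → ℂ)}
    (hW' : IsStableSubmodule 𝒟 W') (hW : IsStableSubmodule 𝒟 W) (hW'W : W' ≤ W) (hWV : W ≤ V) :
    ∃ W₀ : Submodule ℂ (𝒢.Adelic → ℂ), IsStableSubmodule 𝒟 W₀ ∧ W₀ ≤ W ∧ W' ⊓ W₀ = ⊥ ∧
      W' ⊔ W₀ = W := by
  haveI : Fact (IsStableSubmodule 𝒟 V) := ⟨hV⟩
  have htop : sSup {a : StableBelow 𝒟 V | IsAtom a} = ⊤ := by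
    refine top_le_iff.mp ?_
    change V ≤ (sSup {a : StableBelow 𝒟 V | IsAtom a}).1
    refine hVat.trans (sSup_le fun S hS ↦ ?_)
    have hat : IsAtom (StableBelow.mk S hS.2.1 hS.1 : StableBelow 𝒟 V) :=
      StableBelow.isAtom_iff.mpr ⟨hS.2.2.1, hS.2.2.2⟩
    exact (le_sSup hat : StableBelow.mk S hS.2.1 hS.1 ≤ sSup {a : StableBelow 𝒟 V | IsAtom a})
  obtain ⟨s, -, hdisj, hsup, -⟩ := StableBelow.exists_isCompl_of_sSup_atoms_eq_top htop
    (W' := StableBelow.mk W' hW' (hW'W.trans hWV)) (W := StableBelow.mk W hW hWV) hW'W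
  refine ⟨(sSup s).1, (sSup s).2.1, ?_, ?_, congrArg Subtype.val hsup⟩
  · exact (le_sup_right.trans hsup.le : sSup s ≤ StableBelow.mk W hW hWV)
  · have h : StableBelow.mk W' hW' (hW'W.trans hWV) ⊓ sSup s = ⊥ := disjoint_iff.mp hdisj
    exact congrArg Subtype.val h

end Submodules

end Literature.NumberTheory.Automorphic
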